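import Summits.CriticalPhenomena.CardyFormulaZ2.Theorems.CardySusyWardParafermionFamiliesToSLESixAnchorBulk

/-!
# Certificate `KoebeEnvelope ⇒ H` (line `exact-potential-schwarz-christoffel`, crux stmt-CriticalPhenomena-10814):
# the corner Koebe envelope alone implies bulk non-degeneracy of the `q = 1` parafermion

Crux `CardySusyWard.ParafermionFamiliesToSLESix` (stmt-CriticalPhenomena-10814), skeleton line
`exact-potential-schwarz-christoffel` (lead c7).  Its hardest stub `stub_koebeEnvelope : KoebeEnvelope` is the corner
KOEBE ENVELOPE up to the boundary: for every Dobrushin domain `D` and every discretisation family `Λ` (six `IsFamily`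
fields) with the repaired precompactness `ParafermionPrecompactRepairedAt D Λ`, eventually in `δ`, at every corner
`(v, f)` of an inner face with `v` off both discrete arcs,
`‖cornerObs (Λ δ) δ v f‖ ≤ C δ^{1/3} max(dist(δ v, ∂D), δ)^{-1/3}`.

This file records (registered helper `bulkNondegenerate_of_koebeEnvelope`, sorry-free, standard axioms) that this stub
ALONE implies the open Literature fact `H = ParafermionBulkNondegenerate` (Duminil-Copin–Smirnov 2012, Conjecture 8.7's
non-degeneracy at `q = 1` on `ℤ²`, `[status: open]`), so that every potential/Koebe line of the crux is `≥ H`: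

* in the `¬H` world the typed hypothesis `ParafermionPrecompact` holds (`parafermionPrecompact_iff_not_bulkNondegenerate`),
  hence its weakening `ParafermionPrecompactRepairedAt anchorDomain anchorData` (`repaired_of_parafermionPrecompact`) along
  the concrete anchor family (`stub_anchorData_isFamily`), so the envelope holds ALONG `anchorData`, and the vertex
  observable vanishes on compacts (`VertexVanishes anchorDomain anchorData`, `parafermionPrecompact_iff_vanishing`);
* `KoebeEnvelopeGeH.uie_of_ke`: at one scale of the lattice diamond of the anchor square (`S5.anchor_geometry`:
  discrete boundary = the layer `L - 1 ≤ |s| ∨ L - 1 ≤ |d|`, inner faces = `|f₀ + f₁ + 1| < L ∧ |f₀ - f₁| < L`) the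
  per-family envelope gives the collar bound consumed by `TotalSmall.norm_totalVertexSum_le` — `‖cornerObs E δ v f‖ ≤
  C R^{-1/3}` at EVERY corner of lattice depth `R ≥ 1` (`R δ ≤ dist(δ v, Ωᶜ)`): a corner site with `|s| ≥ L - 1` or
  `|d| ≥ L - 1` has depth `R ≤ 2` (`KoebeEnvelopeGeH.depth_le_two`, the trivial bound `‖cornerObs‖ ≤ 1 ≤ C · 8^{-1/3}`),
  and otherwise `v` is off the discrete boundary (so off both arcs), every face at `v` is inner, and
  `dist(δ v, Ωᶜ) ≤ dist(δ v, ∂Ω)` (`∂Ω ⊆ Ωᶜ`, `Ω` open) turns `C δ^{1/3} max(dist, δ)^{-1/3}` into `C R^{-1/3}`;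
* `KoebeEnvelopeGeH.totalSmall_of_keAt`: the assembly of `stub_totalSmall_of_UIE` (p131326) verbatim with the uniform
  inner envelope replaced by the per-family eventual one: `‖totalVertexSum (Λ δ) δ‖ ≤ η δ^{-5/3}` eventually, for every
  `η > 0`, along every anchor family with the envelope and vertex vanishing;
* against the unconditional sharp-order wall bound `not_layerSmall_anchorData` (moment identity p131967 + Ikhlef–Ponsaing's
  strip law, `…AnchorBulk.lean`): contradiction, hence `H`.

References: H. Duminil-Copin, S. Smirnov, *Conformal invariance of lattice models* (2012), §8, Conj. 8.7;
Y. Ikhlef, A. K. Ponsaing, J. Stat. Phys. 149 (2012) 10–36, Prop. 4.7.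
(buildfix 2026-08-20: comment-only re-land to re-enqueue the module build after its blocking imports were repaired; no declaration changed.)
(buildfix 2026-08-20, 09:4xZ: re-enqueue — the 05:1x/05:2x lake attempt ran while the imports were mid-repair (rc 76 / false-green, never re-queued); the closure is rebuilt and green now; no declaration changed.)
-/

noncomputable section

namespace Summit.CriticalPhenomena.CardyFormulaZ2.Theorems.ParafermionFamiliesToSLESix.StripAnchored

open MeasureTheory Filter Set Metric
open scoped Topology
open Literature.Probability.LatticeModels
open Literature.Probability.RandomPlanarGeometry (DobrushinDomain)
open Literature.Barriers.CriticalPhenomena (medialVertexOf)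
open Summit.CriticalPhenomena.CardyFormulaZ2.Theses.CardySusyWard (ParafermionPrecompact)
open Summit.CriticalPhenomena.CardyFormulaZ2.Theorems.ParafermionPrecompact.Negative (IsFamily VanishesOn
  ParafermionPrecompactRepairedAt repaired_of_parafermionPrecompact parafermionPrecompact_iff_vanishing
  parafermionPrecompact_iff_not_bulkNondegenerate)
open Summit.CriticalPhenomena.CardyFormulaZ2.Cruxes.EdgePrecompact.QkzStripBoundaryArm (cornerObs norm_cornerObs_le_one)
open S5 (anchorDomain mem_anchorDomain_carrier)

namespace KoebeEnvelopeGeH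

/-! ## Depth in the anchor square: an upper bound near the four sides -/

/-- A real shift `t` putting `z + t` on one of the four lines `{x + y = ±2}`, `{x - y = ±2}` bounds the depth of `z` in
the anchor square `{|x + y| < 2, |x - y| < 2}` by `|t|`. [folklore] -/
theorem infDist_compl_le_of_shift (z : ℂ) (t : ℝ) (h : |z.re + t + z.im| = 2 ∨ |z.re + t - z.im| = 2) :
    infDist z anchorDomain.carrierᶜ ≤ |t| := by
  have hy : z + (t : ℂ) ∈ anchorDomain.carrierᶜ := by
    rw [Set.mem_compl_iff, mem_anchorDomain_carrier, Complex.add_re, Complex.add_im, Complex.ofReal_re,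
      Complex.ofReal_im, add_zero]
    rintro ⟨h1, h2⟩
    rcases h with h | h
    · exact (ne_of_lt h1) h
    · exact (ne_of_lt h2) h
  calc infDist z anchorDomain.carrierᶜ ≤ dist z (z + (t : ℂ)) := infDist_le_dist_of_mem hy
    _ = |t| := by rw [dist_comm, dist_eq_norm, add_sub_cancel_left, Complex.norm_real, Real.norm_eq_abs]

/-- The one-dimensional core of `depth_le_two`: if the lattice coordinate `q` (`= v₀ + v₁` or `v₀ - v₁`) of a point
`z` at depth `≥ R δ`, `R ≥ 1`, has `|q| ≥ L - 1` (`2 ≤ (L + 1) δ`), then `R ≤ 2` — either `δ |q| ≥ 2` and the depth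
vanishes, or the shift by `±(2 - δ|q|) ≤ 2δ` reaches a side. [folklore] -/
theorem depth_le_two_aux {δ : ℝ} {L q : ℤ} {z : ℂ} {R : ℕ} (hδ : 0 < δ) (hL1 : 2 ≤ ((L : ℝ) + 1) * δ)
    (hR : 1 ≤ R) (hRd : (R : ℝ) * δ ≤ infDist z anchorDomain.carrierᶜ)
    (hz : ∀ t : ℝ, |δ * q + t| = 2 → infDist z anchorDomain.carrierᶜ ≤ |t|)
    (hz2 : 2 ≤ |δ * (q : ℝ)| → infDist z anchorDomain.carrierᶜ = 0) (hq : L - 1 ≤ |q|) : (R : ℝ) ≤ 2 := by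
  have hR1 : (1 : ℝ) ≤ R := by exact_mod_cast hR
  have hq' : (L : ℝ) - 1 ≤ |(q : ℝ)| := by
    have : ((L - 1 : ℤ) : ℝ) ≤ ((|q| : ℤ) : ℝ) := by exact_mod_cast hq
    push_cast at this
    exact this
  have habs : |δ * (q : ℝ)| = δ * |(q : ℝ)| := by rw [abs_mul, abs_of_pos hδ]
  have hlow : 2 - 2 * δ ≤ |δ * (q : ℝ)| := by rw [habs]; nlinarith
  by_cases h2 : 2 ≤ |δ * (q : ℝ)|
  · have h0 := hz2 h2
    rw [h0] at hRd
    nlinarith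
  · rw [not_le] at h2
    set a : ℝ := δ * q with ha
    have key : infDist z anchorDomain.carrierᶜ ≤ 2 - |a| := by
      rcases le_or_gt 0 a with ha0 | ha0
      · have h1 := hz (2 - a) (by rw [show a + (2 - a) = 2 by ring]; norm_num)
        rwa [abs_of_nonneg ha0, ← abs_of_nonneg (show (0:ℝ) ≤ 2 - a by rw [abs_of_nonneg ha0] at h2; linarith)]
      · have h1 := hz (-(2 + a)) (by rw [show a + -(2 + a) = -2 by ring]; norm_num)
        rw [abs_neg] at h1
        rwa [abs_of_neg ha0, show (2 : ℝ) - -a = 2 + a by ring,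
          ← abs_of_nonneg (show (0:ℝ) ≤ 2 + a by rw [abs_of_neg ha0] at h2; linarith)]
    have : (R : ℝ) * δ ≤ 2 * δ := by linarith
    exact le_of_mul_le_mul_right this hδ

/-- **Sites near the discrete boundary of the diamond are shallow.** In the lattice diamond of the anchor square at
mesh `δ` (`2 ≤ (L + 1) δ`), a site `v` at depth `≥ R δ` (`R ≥ 1`) with `|v₀ + v₁| ≥ L - 1` or `|v₀ - v₁| ≥ L - 1` has
`R ≤ 2`. [folklore] -/
theorem depth_le_two {δ : ℝ} {L : ℤ} {v : Site 2} {R : ℕ} (hδ : 0 < δ) (hL1 : 2 ≤ ((L : ℝ) + 1) * δ) (hR : 1 ≤ R)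
    (hRd : (R : ℝ) * δ ≤ infDist (meshPoint δ v) anchorDomain.carrierᶜ)
    (hv : L - 1 ≤ |v 0 + v 1| ∨ L - 1 ≤ |v 0 - v 1|) : (R : ℝ) ≤ 2 := by
  rcases hv with hv | hv
  · refine depth_le_two_aux (q := v 0 + v 1) hδ hL1 hR hRd (fun t ht => ?_) (fun h2 => ?_) hv
    · refine infDist_compl_le_of_shift _ t (Or.inl ?_)
      rw [meshPoint_re, meshPoint_im, ← ht]
      push_cast
      ring_nf
    · refine infDist_zero_of_mem ?_
      rw [Set.mem_compl_iff, mem_anchorDomain_carrier, meshPoint_re, meshPoint_im, not_and_or, not_lt]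
      left
      push_cast at h2
      rwa [show δ * ((v 0 : ℝ) + v 1) = δ * v 0 + δ * v 1 by ring] at h2
  · refine depth_le_two_aux (q := v 0 - v 1) hδ hL1 hR hRd (fun t ht => ?_) (fun h2 => ?_) hv
    · refine infDist_compl_le_of_shift _ t (Or.inr ?_)
      rw [meshPoint_re, meshPoint_im, ← ht]
      push_cast
      ring_nf
    · refine infDist_zero_of_mem ?_
      rw [Set.mem_compl_iff, mem_anchorDomain_carrier, meshPoint_re, meshPoint_im, not_and_or, not_lt, not_lt]
      right
      push_cast at h2
      rwa [show δ * ((v 0 : ℝ) - v 1) = δ * v 0 - δ * v 1 by ring] at h2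

/-! ## From the per-family Koebe envelope to the collar bound of `TotalSmall.norm_totalVertexSum_le` -/

/-- The frontier of the (open) anchor square lies in its complement. [folklore] -/
theorem frontier_subset_compl : frontier anchorDomain.carrier ⊆ anchorDomain.carrierᶜ :=
  (disjoint_frontier_iff_isOpen.2 anchorDomain.isOpen).subset_compl_right

/-- Depth to the complement is at most depth to the frontier (the frontier of the open square lies in the complement and
is nonempty). [folklore] -/
theorem infDist_compl_le_infDist_frontier (z : ℂ) :
    infDist z anchorDomain.carrierᶜ ≤ infDist z (frontier anchorDomain.carrier) :=
  infDist_le_infDist_of_subset frontier_subset_compl ⟨_, anchorDomain.boundary_mem_frontier 0⟩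

/-- **The Koebe envelope at one scale gives the collar bound.** On admissible-type data `E` of the anchor square at mesh
`δ` whose discrete boundary is the layer `L - 1 ≤ |s| ∨ L - 1 ≤ |d|` and whose inner faces are
`|f₀ + f₁ + 1| < L ∧ |f₀ - f₁| < L` (`2 ≤ (L + 1) δ`), the corner envelope `‖cornerObs E δ v f‖ ≤
C δ^{1/3} max(dist(δ v, ∂Ω), δ)^{-1/3}` at the corners of inner faces off the arcs (`C ≥ 2`) yields
`‖cornerObs E δ v f‖ ≤ C R^{-1/3}` at EVERY corner of lattice depth `R ≥ 1`: shallow sites (`|s| ≥ L - 1` or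
`|d| ≥ L - 1`) have `R ≤ 2` and `‖cornerObs‖ ≤ 1 ≤ C/2 ≤ C R^{-1/3}`; deep sites are off the discrete boundary, all their
faces are inner, and `R δ ≤ dist(δ v, Ωᶜ) ≤ max(dist(δ v, ∂Ω), δ)`. [folklore] -/
theorem uie_of_ke {E : DiscreteDobrushin} {δ C : ℝ} {L : ℤ} (hδ : 0 < δ) (hL1 : 2 ≤ ((L : ℝ) + 1) * δ) (hC : 2 ≤ C)
    (hbd : ∀ v : Site 2, v ∈ E.zdBoundary ↔
      (|v 0 + v 1| ≤ L ∧ |v 0 - v 1| ≤ L) ∧ (L - 1 ≤ |v 0 + v 1| ∨ L - 1 ≤ |v 0 - v 1|))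
    (hinner : ∀ f : Site 2, E.IsInnerFace f ↔ |f 0 + f 1 + 1| < L ∧ |f 0 - f 1| < L)
    (hKE : ∀ v f : Site 2, IsCorner v f → E.IsInnerFace f → v ∉ E.zdArcA → v ∉ E.zdArcB →
      ‖cornerObs E δ v f‖ ≤ C * δ ^ ((1:ℝ) / 3) *
        (max (infDist (meshPoint δ v) (frontier anchorDomain.carrier)) δ) ^ (-(1 / 3 : ℝ))) :
    ∀ (v f : Site 2), IsCorner v f → ∀ R : ℕ, 1 ≤ R →
      (R : ℝ) * δ ≤ infDist (meshPoint δ v) anchorDomain.carrierᶜ → ‖cornerObs E δ v f‖ ≤ C * (R : ℝ) ^ (-(1:ℝ) / 3) := by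
  intro v f hvf R hR hRd
  have hR1 : (1 : ℝ) ≤ R := by exact_mod_cast hR
  by_cases hv : L - 1 ≤ |v 0 + v 1| ∨ L - 1 ≤ |v 0 - v 1|
  · -- shallow: `R ≤ 2`, the trivial bound
    have hR2 := depth_le_two hδ hL1 hR hRd hv
    have h1 := norm_cornerObs_le_one E δ v f
    have hhalf : 1 / 2 ≤ (R : ℝ) ^ (-(1:ℝ) / 3) := TotalSmall.half_le_rpow (by positivity) (by linarith)
    calc ‖cornerObs E δ v f‖ ≤ 1 := h1
      _ ≤ C * (1 / 2) := by linarith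
      _ ≤ C * (R : ℝ) ^ (-(1:ℝ) / 3) := mul_le_mul_of_nonneg_left hhalf (by linarith)
  · -- deep: off the discrete boundary, every face inner, the envelope
    rw [not_or, not_le, not_le] at hv
    obtain ⟨hs, hd⟩ := hv
    have hvbd : v ∉ E.zdBoundary := fun h => by
      rcases ((hbd v).1 h).2 with h' | h' <;> omega
    have hvA : v ∉ E.zdArcA := fun h => hvbd (E.zdArcA_subset_zdBoundary h)
    have hvB : v ∉ E.zdArcB := fun h => hvbd (E.zdArcB_subset_zdBoundary h)
    have hf : E.IsInnerFace f := by
      rw [hinner]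
      have h0 := hvf 0
      have h1 := hvf 1
      rw [abs_lt] at hs hd
      constructor <;> rw [abs_lt] <;> constructor <;> omega
    have hb := hKE v f hvf hf hvA hvB
    have hRδ : 0 < (R : ℝ) * δ := by positivity
    have hm : (R : ℝ) * δ ≤ max (infDist (meshPoint δ v) (frontier anchorDomain.carrier)) δ :=
      (hRd.trans (infDist_compl_le_infDist_frontier _)).trans (le_max_left _ _)
    have hpow : (max (infDist (meshPoint δ v) (frontier anchorDomain.carrier)) δ) ^ (-(1 / 3 : ℝ)) ≤
        ((R : ℝ) * δ) ^ (-(1 / 3 : ℝ)) := Real.rpow_le_rpow_of_nonpos hRδ hm (by norm_num)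
    have hsplit : ((R : ℝ) * δ) ^ (-(1 / 3 : ℝ)) = (R : ℝ) ^ (-(1:ℝ) / 3) * δ ^ (-(1 / 3 : ℝ)) := by
      rw [Real.mul_rpow (by positivity) hδ.le, neg_div]
    have hδpow : δ ^ ((1:ℝ) / 3) * δ ^ (-(1 / 3 : ℝ)) = 1 := by
      rw [Real.rpow_neg hδ.le, mul_inv_cancel₀ (Real.rpow_pos_of_pos hδ _).ne']
    have hC0 : 0 ≤ C := by linarith
    calc ‖cornerObs E δ v f‖
        ≤ C * δ ^ ((1:ℝ) / 3) * (max (infDist (meshPoint δ v) (frontier anchorDomain.carrier)) δ) ^ (-(1 / 3 : ℝ)) := hb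
      _ ≤ C * δ ^ ((1:ℝ) / 3) * ((R : ℝ) * δ) ^ (-(1 / 3 : ℝ)) := mul_le_mul_of_nonneg_left hpow (by positivity)
      _ = C * (R : ℝ) ^ (-(1:ℝ) / 3) * (δ ^ ((1:ℝ) / 3) * δ ^ (-(1 / 3 : ℝ))) := by rw [hsplit]; ring
      _ = C * (R : ℝ) ^ (-(1:ℝ) / 3) := by rw [hδpow, mul_one]

/-! ## The vanishing side along an anchor family with the per-family envelope -/

open TotalSmall in
/-- **`stub_totalSmall_of_UIE` with the uniform inner envelope replaced by the per-family Koebe envelope.** Along a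
discretisation family `Λ` of the anchor square with the eventual corner envelope
`‖cornerObs (Λ δ) δ v f‖ ≤ C δ^{1/3} max(dist(δ v, ∂Ω), δ)^{-1/3}` (corners of inner faces, `v` off the arcs) and vertex
vanishing on compacts, the total vertex observable over the random medial vertices is `o(δ^{-5/3})`: given `η`, with
`C = max C₀ 2`, the collar width `h ∈ (0,1)` with `(4h)^{2/3} ≤ η/(960 C)`, the compact `K_h = {h ≤ dist(·, Ωᶜ)}` and
`ε = η/100`, eventually in `δ` (`S5.anchor_geometry`, the envelope, vanishing on `K_h`, `δ < h`) the collar bound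
`uie_of_ke` feeds `norm_totalVertexSum_le`, whence `‖totalVertexSum‖ ≤ (480 C (4h)^{2/3} + 50 ε) δ^{-5/3} ≤ η δ^{-5/3}`.
[folklore] -/
theorem totalSmall_of_keAt {Λ : ℝ → DiscreteDobrushin} (hΛ : IsFamily anchorDomain Λ)
    (hKE : ∃ C : ℝ, ∀ᶠ δ in 𝓝[>] (0:ℝ), ∀ v f : Site 2, IsCorner v f → (Λ δ).IsInnerFace f →
      v ∉ (Λ δ).zdArcA → v ∉ (Λ δ).zdArcB →
        ‖cornerObs (Λ δ) δ v f‖ ≤ C * δ ^ ((1:ℝ) / 3) *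
          (max (Metric.infDist (meshPoint δ v) (frontier anchorDomain.carrier)) δ) ^ (-(1 / 3 : ℝ)))
    (hV : VertexVanishes anchorDomain Λ) :
    ∀ η > (0:ℝ), ∀ᶠ δ in 𝓝[>] (0:ℝ), ‖totalVertexSum (Λ δ) δ‖ ≤ η * δ ^ (-(5:ℝ) / 3) := by
  intro η hη
  obtain ⟨C₀, hC₀⟩ := hKE
  obtain ⟨C, hCdef⟩ : ∃ C : ℝ, C = max C₀ 2 := ⟨_, rfl⟩
  have hC2 : 2 ≤ C := hCdef ▸ le_max_right _ _
  have hC : 1 ≤ C := by linarith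
  have hCC₀ : C₀ ≤ C := hCdef ▸ le_max_left _ _
  have hpow : Filter.Tendsto (fun x : ℝ => (4 * x) ^ ((2:ℝ) / 3)) (𝓝[>] (0:ℝ)) (𝓝 0) := by
    have hc : Continuous (fun x : ℝ => (4 * x) ^ ((2:ℝ) / 3)) :=
      (continuous_const.mul continuous_id).rpow_const fun x => Or.inr (by norm_num)
    simpa [Real.zero_rpow (by norm_num : ((2:ℝ) / 3) ≠ 0)] using tendsto_nhdsWithin_of_tendsto_nhds (hc.tendsto 0)
  -- the collar width `h`, the compact `K`, the smallness `ε`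
  obtain ⟨h, hh1, hh0, hh2⟩ := ((hpow.eventually_le_const (by positivity : (0:ℝ) < η / (960 * C))).and
    (Ioo_mem_nhdsGT (zero_lt_one' ℝ))).exists
  set K : Set ℂ := {z | h ≤ infDist z anchorDomain.carrierᶜ} with hKdef
  have hKD : K ⊆ anchorDomain.carrier := by
    intro z hz
    by_contra hzD
    have h0 : infDist z anchorDomain.carrierᶜ = 0 := Metric.infDist_zero_of_mem hzD
    have : h ≤ infDist z anchorDomain.carrierᶜ := hz
    linarith
  have hK : IsCompact K :=
    Metric.isCompact_of_isClosed_isBounded (isClosed_le continuous_const (Metric.continuous_infDist_pt _))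
      (anchorDomain.isBounded.subset hKD)
  have hε : (0:ℝ) < η / 100 := by positivity
  filter_upwards [S5.anchor_geometry hΛ, hV K hK hKD (η / 100) hε, Ioo_mem_nhdsGT hh0, hC₀] with δ hgeom hVan hδI hKEδ
  obtain ⟨hδ0, hδh⟩ := hδI
  obtain ⟨L, -, hLδ, hL1, hE, hEδ, -, hmesh, -, hbd, hinner, -, -⟩ := hgeom
  have hKE' : ∀ v f : Site 2, IsCorner v f → (Λ δ).IsInnerFace f → v ∉ (Λ δ).zdArcA → v ∉ (Λ δ).zdArcB →
      ‖cornerObs (Λ δ) δ v f‖ ≤ C * δ ^ ((1:ℝ) / 3) *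
        (max (infDist (meshPoint δ v) (frontier anchorDomain.carrier)) δ) ^ (-(1 / 3 : ℝ)) := by
    intro v f hvf hf hA hB
    refine (hKEδ v f hvf hf hA hB).trans (mul_le_mul_of_nonneg_right (mul_le_mul_of_nonneg_right hCC₀
      (Real.rpow_nonneg hδ0.le _)) (Real.rpow_nonneg (hδ0.le.trans (le_max_right _ _)) _))
  have hUIE' := uie_of_ke hδ0 hL1 hC2 hbd hinner hKE'
  have hVan' : ∀ p : Site 2 × Fin 2, h ≤ infDist (medialPoint δ (medialVertexOf p)) anchorDomain.carrierᶜ →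
      ‖vertexObs (Λ δ) δ (medialVertexOf p)‖ ≤ η / 100 * δ ^ ((1:ℝ) / 3) := fun p hp => hVan (medialVertexOf p) hp
  have main := norm_totalVertexSum_le hE hEδ hLδ hL1 hmesh hδh.le (hδh.le.trans hh2.le) hC hε.le hUIE' hVan'
  rw [scale_identity hδ0 hh0.le] at main
  refine main.trans (mul_le_mul_of_nonneg_right ?_ (Real.rpow_nonneg hδ0.le _))
  calc 480 * C * (4 * h) ^ ((2:ℝ) / 3) + 50 * (η / 100) ≤ 480 * C * (η / (960 * C)) + 50 * (η / 100) := by gcongr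
    _ = η := by field_simp; ring

end KoebeEnvelopeGeH

open KoebeEnvelopeGeH in
/-- **Registered helper `bulkNondegenerate_of_koebeEnvelope` (certificate `stub_koebeEnvelope ⇒ H` of the line
`exact-potential-schwarz-christoffel`).** The corner Koebe envelope — for every Dobrushin domain and every discretisation
family with the six `IsFamily` fields and the repaired precompactness, eventually in `δ`, `‖cornerObs (Λ δ) δ v f‖ ≤
C δ^{1/3} max(dist(δ v, ∂D), δ)^{-1/3}` at the corners of inner faces off the discrete arcs (VERBATIM the skeleton's
`KoebeEnvelope`) — implies bulk non-degeneracy of the spin-`1/3` parafermion of critical bond percolation on `ℤ²`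
(Duminil-Copin–Smirnov 2012, Conjecture 8.7's lower bound, the open Literature fact `ParafermionBulkNondegenerate`):
were `H` false, `ParafermionPrecompact` would hold (`parafermionPrecompact_iff_not_bulkNondegenerate`), hence the repaired
precompactness along the concrete anchor family (`repaired_of_parafermionPrecompact`, `stub_anchorData_isFamily`), so
the envelope holds along `anchorData` while the vertex observable vanishes on compacts
(`parafermionPrecompact_iff_vanishing`); `totalSmall_of_keAt` then makes `totalVertexSum (anchorData δ) δ` eventually
`≤ η δ^{-5/3}` for every `η > 0`, against the unconditional wall bound `not_layerSmall_anchorData`.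
[cite: DuminilCopinSmirnov2012Lattice, Conjecture 8.7] -/
theorem bulkNondegenerate_of_koebeEnvelope : (∀ (D : DobrushinDomain) (Λ : ℝ → DiscreteDobrushin), IsFamily D Λ → ParafermionPrecompactRepairedAt D Λ → ∃ C : ℝ, ∀ᶠ δ in 𝓝[>] (0:ℝ), ∀ v f : Site 2, IsCorner v f → (Λ δ).IsInnerFace f → v ∉ (Λ δ).zdArcA → v ∉ (Λ δ).zdArcB → ‖cornerObs (Λ δ) δ v f‖ ≤ C * δ ^ ((1:ℝ) / 3) * (max (Metric.infDist (meshPoint δ v) (frontier D.carrier)) δ) ^ (-(1 / 3 : ℝ))) → ParafermionBulkNondegenerate := by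
  intro hKE
  by_contra hH
  have hP : ParafermionPrecompact := parafermionPrecompact_iff_not_bulkNondegenerate.2 hH
  have hV : VertexVanishes anchorDomain anchorData := fun K hK hKD =>
    (parafermionPrecompact_iff_vanishing.1 hP) anchorDomain anchorData stub_anchorData_isFamily K hK hKD
  exact not_layerSmall_anchorData fun η hη =>
    (totalSmall_of_keAt stub_anchorData_isFamily (hKE anchorDomain anchorData stub_anchorData_isFamily
      (repaired_of_parafermionPrecompact hP anchorDomain anchorData)) hV η hη).frequently

end Summit.CriticalPhenomena.CardyFormulaZ2.Theorems.ParafermionFamiliesToSLESix.StripAnchored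

end
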